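import Literature.MathematicalPhysics.KineticTheory.HardSphereUniformGas
import Literature.MathematicalPhysics.KineticTheory.CollisionFluxUpperBound

/-!
# Cold balls, part A: Gaussian tools for the equilibrium stub `eq_coldBalls`

Lead c2's stub of the equilibrium side-composition of line `exact-entropy-ledger-three-passivities` for the crux
`JParityClosure.LocalSecondLaw` (stmt-AtomisticToContinuum-13081).  Velocity-side inputs, all about the product
Maxwellian law `Q = ⊗ᵢ gaussMeasure ū Θ` on `Fin (N+1) → V3`:

* `pi_weighted_sum_tail_le` — Chebyshev for a WEIGHTED sum of i.i.d. centred `L²` variables under `Q`: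
  `Q{δ ≤ |∑ cᵢ Y(vᵢ)|} ≤ (∑cᵢ²)·Var Y/δ²`;
* `gaussMeasure_prod_norm_sub_le` / `pi_gaussMeasure_norm_sub_le` — SMALL-BALL bound for the difference of two
  independent Maxwellian velocities: `Q{‖vᵢ − vⱼ‖ ≤ u} ≤ (2πΘ)^{-3/2}·(4π/3)u³` (bounded density × ball volume);
* `coldBalls_logMomentFour` (registered sub-goal), `lintegral_posLogInv_sq_le` — FINITE LOG-MOMENTS: `E_Q[(log⁺(1/‖vᵢ−vⱼ‖))⁴]` is bounded by
  `64·D(Θ)`, `D(Θ) = (2πΘ)^{-3/2}(4π/3)` (dyadic shells + the small-ball bound + `s⁴ ≤ 24 eˢ`).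
-/

noncomputable section

namespace Summit.AtomisticToContinuum.HydrodynamicLimit.Theorems.LocalSecondLawEquilibrium

open scoped BigOperators Topology Classical MeasureTheory ENNReal InnerProductSpace
open Filter Set MeasureTheory ProbabilityTheory
open Literature.MathematicalPhysics.KineticTheory
open Literature.Analysis.FluidPDE

/-! ## Chebyshev for weighted sums under a product measure -/

/-- **Chebyshev for a weighted sum of i.i.d. centred square-integrable variables** under the product measure:
`(⊗γ) {δ ≤ |∑ᵢ cᵢ Y(vᵢ)|} ≤ (∑ᵢ cᵢ²) Var[Y] / δ²`. -/
theorem pi_weighted_sum_tail_le {ι V : Type*} [Fintype ι] [MeasurableSpace V] (γ : Measure V)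
    [IsProbabilityMeasure γ] {Y : V → ℝ} (hY : MemLp Y 2 γ) (h0 : ∫ v, Y v ∂γ = 0) (c : ι → ℝ)
    {δ : ℝ} (hδ : 0 < δ) :
    Measure.pi (fun _ : ι => γ) {v | δ ≤ |∑ i, c i * Y (v i)|} ≤
      ENNReal.ofReal ((∑ i, c i ^ 2) * Var[Y; γ] / δ ^ 2) := by
  set X : ι → V → ℝ := fun i v => c i * Y v with hXdef
  have hX : ∀ i, MemLp (X i) 2 γ := fun i => hY.const_mul (c i)
  set S : (ι → V) → ℝ := ∑ i, fun v => X i (v i) with hS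
  have hSi : ∀ i, MemLp (fun v : ι → V => X i (v i)) 2 (Measure.pi fun _ : ι => γ) := fun i =>
    (hX i).comp_measurePreserving (measurePreserving_eval (fun _ : ι => γ) i)
  have hSm : MemLp S 2 (Measure.pi fun _ : ι => γ) := memLp_finsetSum' _ fun i _ => hSi i
  have hSapply : ∀ v, S v = ∑ i, c i * Y (v i) := fun v => by simp [hS, hXdef]
  have hmean_i : ∀ i, ∫ v, X i (v i) ∂Measure.pi (fun _ : ι => γ) = 0 := by
    intro i
    have h := integral_map (μ := Measure.pi fun _ : ι => γ) (measurable_pi_apply i).aemeasurable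
      (f := X i) (by rw [(measurePreserving_eval (fun _ : ι => γ) i).map_eq]; exact (hX i).aestronglyMeasurable)
    rw [(measurePreserving_eval (fun _ : ι => γ) i).map_eq] at h
    rw [← h]
    simp only [hXdef, integral_const_mul, h0, mul_zero]
  have hmean : ∫ v, S v ∂Measure.pi (fun _ : ι => γ) = 0 := by
    have : S = fun v => ∑ i, X i (v i) := by funext v; simp [hS]
    rw [this, integral_finsetSum _ fun i _ => (hSi i).integrable one_le_two]
    simp [hmean_i]
  have hvar : Var[S; Measure.pi fun _ : ι => γ] = (∑ i, c i ^ 2) * Var[Y; γ] := by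
    rw [hS, variance_sum_pi hX, Finset.sum_mul]
    refine Finset.sum_congr rfl fun i _ => ?_
    simp only [hXdef]
    exact variance_const_mul (c i) Y γ
  have hset : {v : ι → V | δ ≤ |∑ i, c i * Y (v i)|} =
      {v | δ ≤ |S v - ∫ w, S w ∂Measure.pi (fun _ : ι => γ)|} := by
    ext v; rw [mem_setOf_eq, mem_setOf_eq, hmean, sub_zero, hSapply]
  calc Measure.pi (fun _ : ι => γ) {v | δ ≤ |∑ i, c i * Y (v i)|}
      = Measure.pi (fun _ : ι => γ) {v | δ ≤ |S v - ∫ w, S w ∂Measure.pi (fun _ : ι => γ)|} := by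
        rw [hset]
    _ ≤ ENNReal.ofReal (Var[S; Measure.pi fun _ : ι => γ] / δ ^ 2) := meas_ge_le_variance_div_sq hSm hδ
    _ = ENNReal.ofReal ((∑ i, c i ^ 2) * Var[Y; γ] / δ ^ 2) := by rw [hvar]

/-! ## Small balls for the difference of two Maxwellian velocities -/

/-- The local Maxwellian density is bounded by its prefactor `(2πθ)^{-3/2}` (unit mass). -/
theorem localMaxwellian_one_le {θ : ℝ} (hθ : 0 < θ) (u v : V3) :
    localMaxwellian 1 θ u v ≤ (2 * Real.pi * θ) ^ (-(3 : ℝ) / 2) := by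
  unfold localMaxwellian
  rw [one_mul, finrank_euclideanSpace, Fintype.card_fin]
  have h1 : Real.exp (-‖v - u‖ ^ 2 / (2 * θ)) ≤ 1 := by
    rw [Real.exp_le_one_iff, neg_div]
    have : 0 ≤ ‖v - u‖ ^ 2 / (2 * θ) := by positivity
    linarith
  have h0 : 0 ≤ (2 * Real.pi * θ) ^ (-(3 : ℝ) / 2) := by positivity
  push_cast
  nlinarith

/-- A Maxwellian gives every closed ball of radius `u` mass at most `(2πΘ)^{-3/2} · (4π/3) u³`. -/
theorem gaussMeasure_closedBall_le (ū c : V3) {Θ : ℝ} (hΘ : 0 < Θ) {u : ℝ} (hu : 0 ≤ u) :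
    gaussMeasure ū Θ (Metric.closedBall c u) ≤
      ENNReal.ofReal ((2 * Real.pi * Θ) ^ (-(3 : ℝ) / 2) * (4 / 3 * Real.pi * u ^ 3)) := by
  rw [← withDensity_localMaxwellian_eq_gaussMeasure hΘ ū, withDensity_apply _ measurableSet_closedBall]
  calc ∫⁻ v in Metric.closedBall c u, ENNReal.ofReal (localMaxwellian 1 Θ ū v)
      ≤ ∫⁻ _v in Metric.closedBall c u, ENNReal.ofReal ((2 * Real.pi * Θ) ^ (-(3 : ℝ) / 2)) :=
        lintegral_mono fun v => ENNReal.ofReal_le_ofReal (localMaxwellian_one_le hΘ ū v)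
    _ = ENNReal.ofReal ((2 * Real.pi * Θ) ^ (-(3 : ℝ) / 2)) * volume (Metric.closedBall c u) :=
        setLIntegral_const _ _
    _ = ENNReal.ofReal ((2 * Real.pi * Θ) ^ (-(3 : ℝ) / 2) * (4 / 3 * Real.pi * u ^ 3)) := by
        rw [Measure.addHaar_closedBall_eq_addHaar_ball, EuclideanSpace.volume_ball_fin_three,
          ← ENNReal.ofReal_pow hu, ← ENNReal.ofReal_mul (by positivity), ← ENNReal.ofReal_mul (by positivity)]
        congr 1; ring

/-- **Small-ball bound for the difference of two independent Maxwellian velocities** (product form). -/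
theorem gaussMeasure_prod_norm_sub_le (ū : V3) {Θ : ℝ} (hΘ : 0 < Θ) {u : ℝ} (hu : 0 ≤ u) :
    ((gaussMeasure ū Θ).prod (gaussMeasure ū Θ)) {p : V3 × V3 | ‖p.1 - p.2‖ ≤ u} ≤
      ENNReal.ofReal ((2 * Real.pi * Θ) ^ (-(3 : ℝ) / 2) * (4 / 3 * Real.pi * u ^ 3)) := by
  have hmeas : MeasurableSet {p : V3 × V3 | ‖p.1 - p.2‖ ≤ u} :=
    measurableSet_le (continuous_fst.sub continuous_snd).norm.measurable measurable_const
  rw [Measure.prod_apply hmeas]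
  have hsec : ∀ x : V3, (Prod.mk x) ⁻¹' {p : V3 × V3 | ‖p.1 - p.2‖ ≤ u} = Metric.closedBall x u := by
    intro x; ext y
    simp only [mem_preimage, mem_setOf_eq, Metric.mem_closedBall, dist_eq_norm, norm_sub_rev]
  simp_rw [hsec]
  calc ∫⁻ x, gaussMeasure ū Θ (Metric.closedBall x u) ∂gaussMeasure ū Θ
      ≤ ∫⁻ _x, ENNReal.ofReal ((2 * Real.pi * Θ) ^ (-(3 : ℝ) / 2) * (4 / 3 * Real.pi * u ^ 3))
          ∂gaussMeasure ū Θ := lintegral_mono fun x => gaussMeasure_closedBall_le ū x hΘ hu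
    _ = _ := by rw [lintegral_const, measure_univ, mul_one]

/-- **Small-ball bound under the product Maxwellian law** for two distinct labels `i ≠ j`. -/
theorem pi_gaussMeasure_norm_sub_le {n : ℕ} (ū : V3) {Θ : ℝ} (hΘ : 0 < Θ) {i j : Fin n} (hij : i ≠ j)
    {u : ℝ} (hu : 0 ≤ u) :
    Measure.pi (fun _ : Fin n => gaussMeasure ū Θ) {v | ‖v i - v j‖ ≤ u} ≤
      ENNReal.ofReal ((2 * Real.pi * Θ) ^ (-(3 : ℝ) / 2) * (4 / 3 * Real.pi * u ^ 3)) := by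
  have hmeas : MeasurableSet {p : V3 × V3 | ‖p.1 - p.2‖ ≤ u} :=
    measurableSet_le (continuous_fst.sub continuous_snd).norm.measurable measurable_const
  have h := lintegral_pi_pair (gaussMeasure ū Θ) hij (f := ({p : V3 × V3 | ‖p.1 - p.2‖ ≤ u}).indicator 1)
    ((measurable_indicator_const_iff 1).2 hmeas)
  rw [lintegral_indicator_one hmeas] at h
  have hset : {v : Fin n → V3 | ‖v i - v j‖ ≤ u} = (fun v => (v i, v j)) ⁻¹' {p : V3 × V3 | ‖p.1 - p.2‖ ≤ u} := rfl
  rw [hset, ← lintegral_indicator_one (hmeas.preimage ((measurable_pi_apply i).prodMk (measurable_pi_apply j)))]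
  have : (fun v : Fin n → V3 => ((fun v => (v i, v j)) ⁻¹' {p : V3 × V3 | ‖p.1 - p.2‖ ≤ u}).indicator
      (1 : (Fin n → V3) → ℝ≥0∞) v) = fun v => ({p : V3 × V3 | ‖p.1 - p.2‖ ≤ u}).indicator 1 (v i, v j) := by
    funext v
    simp only [Set.indicator, mem_preimage, Pi.one_apply]
  rw [this, h]
  exact gaussMeasure_prod_norm_sub_le ū hΘ hu

/-! ## Finite log-moments of the velocity difference -/

/-- The positive part of `log(1/t)` to the fourth is at most `24/t` on `t > 0`. -/
theorem posLogInv_pow_four_le {t : ℝ} (ht : 0 < t) : (max 0 (Real.log t⁻¹)) ^ 4 ≤ 24 * t⁻¹ := by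
  by_cases h1 : t < 1
  · have hlog : 0 ≤ Real.log t⁻¹ := Real.log_nonneg (one_le_inv_iff₀.2 ⟨ht, h1.le⟩)
    rw [max_eq_right hlog]
    have h := Real.pow_div_factorial_le_exp (Real.log t⁻¹) hlog 4
    have h24 : ((4 : ℕ).factorial : ℝ) = 24 := by norm_num [Nat.factorial]
    rw [h24, div_le_iff₀ (by norm_num : (0 : ℝ) < 24), Real.exp_log (inv_pos.2 ht)] at h
    linarith
  · have hlog : Real.log t⁻¹ ≤ 0 := by
      rw [Real.log_inv]; exact neg_nonpos.2 (Real.log_nonneg (not_lt.1 h1))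
    rw [max_eq_left hlog]
    have : 0 ≤ 24 * t⁻¹ := by positivity
    simpa using this

/-- Dyadic majorant: `t⁻¹·𝟙{t < 1} ≤ ∑ₘ 2^{m+1} 𝟙{t ≤ 2^{-m}}` for `t > 0` (as an `ℝ≥0∞` sum). -/
theorem inv_indicator_le_tsum {t : ℝ} (ht : 0 < t) :
    ENNReal.ofReal (if t < 1 then t⁻¹ else 0) ≤
      ∑' m : ℕ, (if t ≤ (2 : ℝ)⁻¹ ^ m then ((2 : ℝ≥0∞) ^ (m + 1)) else 0) := by
  split_ifs with h1
  · -- choose `m` with `2^{-(m+1)} < t ≤ 2^{-m}`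
    obtain ⟨m, hm1, hm2⟩ : ∃ m : ℕ, (2 : ℝ)⁻¹ ^ (m + 1) < t ∧ t ≤ (2 : ℝ)⁻¹ ^ m := by
      have hex : ∃ m : ℕ, (2 : ℝ)⁻¹ ^ m < t := exists_pow_lt_of_lt_one ht (by norm_num)
      classical
      have hm₀ : (2 : ℝ)⁻¹ ^ Nat.find hex < t := Nat.find_spec hex
      have hm₀pos : Nat.find hex ≠ 0 := by
        intro h0; rw [h0, pow_zero] at hm₀; linarith
      have hle : t ≤ (2 : ℝ)⁻¹ ^ (Nat.find hex - 1) := by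
        have := Nat.find_min hex (m := Nat.find hex - 1) (by omega)
        exact not_lt.1 this
      refine ⟨Nat.find hex - 1, ?_, hle⟩
      rwa [Nat.sub_add_cancel (Nat.one_le_iff_ne_zero.2 hm₀pos)]
    calc ENNReal.ofReal t⁻¹ ≤ ENNReal.ofReal (2 ^ (m + 1)) := by
          refine ENNReal.ofReal_le_ofReal ?_
          rw [inv_pow] at hm1
          have := one_div_le_one_div_of_le (by positivity) hm1.le
          rw [one_div, one_div, inv_inv] at this
          exact this
      _ = (2 : ℝ≥0∞) ^ (m + 1) := by
          rw [ENNReal.ofReal_pow (by norm_num)]; norm_num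
      _ = (if t ≤ (2 : ℝ)⁻¹ ^ m then ((2 : ℝ≥0∞) ^ (m + 1)) else 0) := by rw [if_pos hm2]
      _ ≤ ∑' m : ℕ, (if t ≤ (2 : ℝ)⁻¹ ^ m then ((2 : ℝ≥0∞) ^ (m + 1)) else 0) := ENNReal.le_tsum m
  · simp


/-- The small-ball bound in the form `Q{‖vᵢ − vⱼ‖ ≤ u} ≤ D(Θ) u³`. -/
theorem pi_gaussMeasure_norm_sub_le' {n : ℕ} (ū : V3) {Θ : ℝ} (hΘ : 0 < Θ) {i j : Fin n} (hij : i ≠ j)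
    {u : ℝ} (hu : 0 ≤ u) :
    Measure.pi (fun _ : Fin n => gaussMeasure ū Θ) {v | ‖v i - v j‖ ≤ u} ≤
      ENNReal.ofReal (((2 * Real.pi * Θ) ^ (-(3 : ℝ) / 2) * (4 / 3 * Real.pi)) * u ^ 3) := by
  refine (pi_gaussMeasure_norm_sub_le ū hΘ hij hu).trans (le_of_eq ?_)
  congr 1; ring

/-- **Finite fourth log-moment of the velocity difference** (registered sub-goal `coldBalls_logMomentFour` of stub
`eq_coldBalls`): under the product Maxwellian law, `E[(log⁺(1/‖vᵢ − vⱼ‖))⁴] ≤ 64·D(Θ)` for `i ≠ j` (dyadic shells,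
small balls, `s⁴ ≤ 24eˢ`). -/
theorem coldBalls_logMomentFour :
    ∀ {n : ℕ} (ū : V3) {Θ : ℝ}, 0 < Θ → ∀ {i j : Fin n}, i ≠ j → ∫⁻ v, ENNReal.ofReal ((max 0 (Real.log ‖v i - v j‖⁻¹)) ^ 4) ∂Measure.pi (fun _ : Fin n => gaussMeasure ū Θ) ≤ ENNReal.ofReal (64 * ((2 * Real.pi * Θ) ^ (-(3 : ℝ) / 2) * (4 / 3 * Real.pi))) := by
  intro n ū Θ hΘ i j hij
  set Q : Measure (Fin n → V3) := Measure.pi fun _ : Fin n => gaussMeasure ū Θ with hQ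
  set D : ℝ := ((2 * Real.pi * Θ) ^ (-(3 : ℝ) / 2) * (4 / 3 * Real.pi)) with hD
  have hD0 : 0 ≤ D := by positivity
  -- pointwise dyadic majorant
  have hpt : ∀ v : Fin n → V3, ENNReal.ofReal ((max 0 (Real.log ‖v i - v j‖⁻¹)) ^ 4) ≤
      24 * ∑' m : ℕ, (if ‖v i - v j‖ ≤ (2 : ℝ)⁻¹ ^ m then ((2 : ℝ≥0∞) ^ (m + 1)) else 0) := by
    intro v
    by_cases h0 : ‖v i - v j‖ = 0
    · rw [h0, inv_zero, Real.log_zero, max_self, zero_pow four_ne_zero, ENNReal.ofReal_zero]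
      exact zero_le
    have ht : 0 < ‖v i - v j‖ := lt_of_le_of_ne (norm_nonneg _) (Ne.symm h0)
    calc ENNReal.ofReal ((max 0 (Real.log ‖v i - v j‖⁻¹)) ^ 4)
        ≤ ENNReal.ofReal (24 * (if ‖v i - v j‖ < 1 then ‖v i - v j‖⁻¹ else 0)) := by
          refine ENNReal.ofReal_le_ofReal ?_
          split_ifs with h1
          · exact posLogInv_pow_four_le ht
          · have hlog : Real.log ‖v i - v j‖⁻¹ ≤ 0 := by
              rw [Real.log_inv]; exact neg_nonpos.2 (Real.log_nonneg (not_lt.1 h1))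
            rw [max_eq_left hlog]; norm_num
      _ = 24 * ENNReal.ofReal (if ‖v i - v j‖ < 1 then ‖v i - v j‖⁻¹ else 0) := by
          rw [ENNReal.ofReal_mul (by norm_num)]; norm_num
      _ ≤ 24 * ∑' m : ℕ, (if ‖v i - v j‖ ≤ (2 : ℝ)⁻¹ ^ m then ((2 : ℝ≥0∞) ^ (m + 1)) else 0) := by
          gcongr; exact inv_indicator_le_tsum ht
  have hmeasS : ∀ m : ℕ, MeasurableSet {v : Fin n → V3 | ‖v i - v j‖ ≤ (2 : ℝ)⁻¹ ^ m} := fun m =>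
    measurableSet_le ((measurable_pi_apply i).sub (measurable_pi_apply j)).norm measurable_const
  have hind : ∀ (m : ℕ) (v : Fin n → V3),
      (if ‖v i - v j‖ ≤ (2 : ℝ)⁻¹ ^ m then ((2 : ℝ≥0∞) ^ (m + 1)) else 0) =
        {v : Fin n → V3 | ‖v i - v j‖ ≤ (2 : ℝ)⁻¹ ^ m}.indicator (fun _ => (2 : ℝ≥0∞) ^ (m + 1)) v := by
    intro m v; simp only [Set.indicator, mem_setOf_eq]
  have hmeasF : ∀ m : ℕ, Measurable fun v : Fin n → V3 =>
      (if ‖v i - v j‖ ≤ (2 : ℝ)⁻¹ ^ m then ((2 : ℝ≥0∞) ^ (m + 1)) else 0) := by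
    intro m
    have : (fun v : Fin n → V3 => (if ‖v i - v j‖ ≤ (2 : ℝ)⁻¹ ^ m then ((2 : ℝ≥0∞) ^ (m + 1)) else 0)) =
        {v : Fin n → V3 | ‖v i - v j‖ ≤ (2 : ℝ)⁻¹ ^ m}.indicator (fun _ => (2 : ℝ≥0∞) ^ (m + 1)) :=
      funext (hind m)
    rw [this]
    exact measurable_const.indicator (hmeasS m)
  -- the geometric terms
  have hterm : ∀ m : ℕ, (2 : ℝ≥0∞) ^ (m + 1) * Q {v | ‖v i - v j‖ ≤ (2 : ℝ)⁻¹ ^ m} ≤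
      ENNReal.ofReal (2 * D * (4 : ℝ)⁻¹ ^ m) := by
    intro m
    have hsb := pi_gaussMeasure_norm_sub_le' ū hΘ hij (u := (2 : ℝ)⁻¹ ^ m) (by positivity)
    calc (2 : ℝ≥0∞) ^ (m + 1) * Q {v | ‖v i - v j‖ ≤ (2 : ℝ)⁻¹ ^ m}
        ≤ (2 : ℝ≥0∞) ^ (m + 1) * ENNReal.ofReal (D * ((2 : ℝ)⁻¹ ^ m) ^ 3) := by gcongr
      _ = ENNReal.ofReal (2 ^ (m + 1) * (D * ((2 : ℝ)⁻¹ ^ m) ^ 3)) := by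
          rw [ENNReal.ofReal_mul (by positivity : (0 : ℝ) ≤ 2 ^ (m + 1)), ENNReal.ofReal_pow zero_le_two,
            ENNReal.ofReal_ofNat]
      _ = ENNReal.ofReal (2 * D * (4 : ℝ)⁻¹ ^ m) := by
          congr 1
          have h4 : (4 : ℝ)⁻¹ ^ m = ((2 : ℝ)⁻¹ ^ m) ^ 2 := by
            rw [← pow_mul, mul_comm, pow_mul]; norm_num
          rw [h4, pow_succ]
          have h2 : (2 : ℝ) ^ m * (2 : ℝ)⁻¹ ^ m = 1 := by rw [← mul_pow]; norm_num
          linear_combination D * ((2 : ℝ)⁻¹ ^ m) ^ 2 * 2 * h2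
  have hgeo : ∑' m : ℕ, ENNReal.ofReal (2 * D * (4 : ℝ)⁻¹ ^ m) = ENNReal.ofReal (8 * D / 3) := by
    have hsum : Summable fun m : ℕ => 2 * D * (4 : ℝ)⁻¹ ^ m :=
      (summable_geometric_of_lt_one (by norm_num) (by norm_num)).mul_left _
    rw [← ENNReal.ofReal_tsum_of_nonneg (fun m => by positivity) hsum, tsum_mul_left,
      tsum_geometric_of_lt_one (by norm_num) (by norm_num)]
    congr 1; norm_num; ring
  calc ∫⁻ v, ENNReal.ofReal ((max 0 (Real.log ‖v i - v j‖⁻¹)) ^ 4) ∂Q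
      ≤ ∫⁻ v, 24 * ∑' m : ℕ, (if ‖v i - v j‖ ≤ (2 : ℝ)⁻¹ ^ m then ((2 : ℝ≥0∞) ^ (m + 1)) else 0) ∂Q :=
        lintegral_mono hpt
    _ = 24 * ∑' m : ℕ, ∫⁻ v, (if ‖v i - v j‖ ≤ (2 : ℝ)⁻¹ ^ m then ((2 : ℝ≥0∞) ^ (m + 1)) else 0) ∂Q := by
        rw [lintegral_const_mul' _ _ (by norm_num), lintegral_tsum fun m => (hmeasF m).aemeasurable]
    _ = 24 * ∑' m : ℕ, (2 : ℝ≥0∞) ^ (m + 1) * Q {v | ‖v i - v j‖ ≤ (2 : ℝ)⁻¹ ^ m} := by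
        congr 1; refine tsum_congr fun m => ?_
        rw [show (fun v : Fin n → V3 => (if ‖v i - v j‖ ≤ (2 : ℝ)⁻¹ ^ m then ((2 : ℝ≥0∞) ^ (m + 1)) else 0)) =
          {v : Fin n → V3 | ‖v i - v j‖ ≤ (2 : ℝ)⁻¹ ^ m}.indicator (fun _ => (2 : ℝ≥0∞) ^ (m + 1)) from
          funext (hind m), lintegral_indicator_const (hmeasS m)]
    _ ≤ 24 * ∑' m : ℕ, ENNReal.ofReal (2 * D * (4 : ℝ)⁻¹ ^ m) := by
        gcongr with m; exact hterm m
    _ = ENNReal.ofReal (64 * D) := by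
        rw [hgeo, show (24 : ℝ≥0∞) = ENNReal.ofReal 24 by norm_num, ← ENNReal.ofReal_mul (by norm_num)]
        congr 1; ring


/-- **Finite second log-moment of the velocity difference**: `E[(log⁺(1/‖vᵢ − vⱼ‖))²] ≤ 1 + 64·D(Θ)`. -/
theorem lintegral_posLogInv_sq_le {n : ℕ} (ū : V3) {Θ : ℝ} (hΘ : 0 < Θ) {i j : Fin n} (hij : i ≠ j) :
    ∫⁻ v, ENNReal.ofReal ((max 0 (Real.log ‖v i - v j‖⁻¹)) ^ 2) ∂Measure.pi (fun _ : Fin n => gaussMeasure ū Θ) ≤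
      ENNReal.ofReal (1 + 64 * ((2 * Real.pi * Θ) ^ (-(3 : ℝ) / 2) * (4 / 3 * Real.pi))) := by
  have hD0 : 0 ≤ ((2 * Real.pi * Θ) ^ (-(3 : ℝ) / 2) * (4 / 3 * Real.pi)) := by positivity
  have hmeas : Measurable fun v : Fin n → V3 => ENNReal.ofReal ((max 0 (Real.log ‖v i - v j‖⁻¹)) ^ 4) :=
    ((measurable_const.max (Real.measurable_log.comp
      ((measurable_pi_apply i).sub (measurable_pi_apply j)).norm.inv)).pow_const 4).ennreal_ofReal
  calc ∫⁻ v, ENNReal.ofReal ((max 0 (Real.log ‖v i - v j‖⁻¹)) ^ 2) ∂Measure.pi (fun _ : Fin n => gaussMeasure ū Θ)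
      ≤ ∫⁻ v, (1 + ENNReal.ofReal ((max 0 (Real.log ‖v i - v j‖⁻¹)) ^ 4))
          ∂Measure.pi (fun _ : Fin n => gaussMeasure ū Θ) := by
        refine lintegral_mono fun v => ?_
        calc ENNReal.ofReal ((max 0 (Real.log ‖v i - v j‖⁻¹)) ^ 2)
            ≤ ENNReal.ofReal (1 + (max 0 (Real.log ‖v i - v j‖⁻¹)) ^ 4) :=
              ENNReal.ofReal_le_ofReal (by nlinarith [sq_nonneg ((max 0 (Real.log ‖v i - v j‖⁻¹)) ^ 2 - 1)])
          _ = 1 + ENNReal.ofReal ((max 0 (Real.log ‖v i - v j‖⁻¹)) ^ 4) := by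
              rw [ENNReal.ofReal_add zero_le_one (by positivity), ENNReal.ofReal_one]
    _ = 1 + ∫⁻ v, ENNReal.ofReal ((max 0 (Real.log ‖v i - v j‖⁻¹)) ^ 4)
          ∂Measure.pi (fun _ : Fin n => gaussMeasure ū Θ) := by
        rw [lintegral_add_left measurable_const, lintegral_const, measure_univ, mul_one]
    _ ≤ 1 + ENNReal.ofReal (64 * ((2 * Real.pi * Θ) ^ (-(3 : ℝ) / 2) * (4 / 3 * Real.pi))) := by
        gcongr; exact coldBalls_logMomentFour ū hΘ hij
    _ = ENNReal.ofReal (1 + 64 * ((2 * Real.pi * Θ) ^ (-(3 : ℝ) / 2) * (4 / 3 * Real.pi))) := by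
        rw [ENNReal.ofReal_add zero_le_one (by positivity), ENNReal.ofReal_one]

end Summit.AtomisticToContinuum.HydrodynamicLimit.Theorems.LocalSecondLawEquilibrium

end
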